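import Summits.ResolutionOfSingularities.ResolutionOfSingularities.Theorems.FrobeniusLadderFInjectiveMacaulayficationSigma7Lx6q7d5PointFloor
import Summits.ResolutionOfSingularities.ResolutionOfSingularities.Theorems.FrobeniusLadderFInjectiveMacaulayficationF108ClassRowUnconditional
import Summits.ResolutionOfSingularities.ResolutionOfSingularities.Theorems.FrobeniusLadderFInjectiveMacaulayficationPolyAutRowTransport
import Summits.ResolutionOfSingularities.ResolutionOfSingularities.Theorems.FrobeniusLadderFInjectiveMacaulayficationGermOfGlobalBlowup
import HarnessLib

/-!
# ★★ THIN APPLICATION (R22.30/R22.31): the (5,2) census bed d5lx6q7 `z² + x⁶z + y³ + u³ + t³ + s⁷` (char 2, six variables) — POINT-FLOOR TWO-SIDED ROW AND GERM,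
# UNCONDITIONALLY, by res-L1-toric-fanʼs ✓ p688090 `F108ClassRow.pointFloorRow_of_convenient_of_ringEquiv` on the shifted bed `f′ = σ₇ f = z² + x⁶z + x¹³ + x¹⁴ + y³ + u³ + t³ + s⁷`
# (no fan tables, no cover data: the toric debt is discharged in the kernel by ✓ p687854 `F108Consumable_holds`)
# (crux `FInjectiveMacaulayfication` stmt-ResolutionOfSingularities-15315, chain w45a; res-L1-w45a-plan-1 RULINGs R22.30 (3) / R22.31 (3) «thin `…_uncond` rows for Lx6q7d5»;
# seat res-L1-w45a-stub-2 g11; hypotheses = this seatʼs `Sigma7Lx6q7d5Specimen` (prime, hWND, hXne, hreg) + `Sigma7Lx6q7d5PointFloor` (θ-charts, Fedder witness, vertex singular))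

[OURS · L1 W4.5a] Support file (`--supports stmt-ResolutionOfSingularities-15315 --as helper`); def-free, unconditional; replaces the role of NO printed item;
NOT a statement of the manuscript; AI-written (AI review is weaker than expert review). A point-floor row of a census bed (row (5,2) #2ʼs bed, ✓ p658464 by cells),
OURS counted 0; nothing of the crux is proved.

* §1 `hconv` — `f′` is CONVENIENT (`z², x¹³, y³, u³, t³, s⁷` have coefficient 1); `aeval_shift` — `σ₇ f = f′` in characteristic 2 (`σ₇ : z ↦ z + x⁷`, `z = X 5`);
* §2 ★★ `pointFloorRow_Lx6q7d5_uncond` — LEGAL ∧ NOT F(5)-iso (p = 2) ∧ CURED for EVERY blowing up of `Spec 𝒪_{V(f),v}` along the point floor (`k = k̄`), ONE term on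
  `pointFloorRow_of_convenient_of_ringEquiv` with `φ` from `PolyAutRowTransport.exists_translate k 0 5 _ 1 7`;
* §3 ★ `lx6q7d5_fInjectivizationGermAt_uncond` — the germ shape, from `affineBlowup_fullCl_of_convenient` + ✓ `GermOfGlobalBlowup.fInjectivizationGermAt_of_affineBlowup`
  + `fInjectivizationGermAt_of_algEquiv`.
[OURS · thin application of landed theorems] [cite: IshiiSingularities2018, Thm. 4.4.23; StacksProject, Tag 080A; GortzWedhorn2020, Prop. 13.91 (2), (13.19)]
-/

-- single-problem summit: the doubled namespace component is forced
set_option linter.dupNamespace false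

noncomputable section

open AlgebraicGeometry CategoryTheory Literature.AlgebraicGeometry.Resolution TopologicalSpace IsLocalRing MvPolynomial

namespace Summit.ResolutionOfSingularities.ResolutionOfSingularities.Theorems.FInjectiveMacaulayfication.Sigma7Lx6q7d5PointFloorRowUncond

open Summit.ResolutionOfSingularities.ResolutionOfSingularities.Theorems.FInjectiveMacaulayfication
open SliceableCentre GermForm

/-! ## §1 Convenience of `f′` and the shift identity -/

/-- `f′` as the sum of its eight monomials with exponents read through `Finsupp.equivFunOnFinite.symm`. [folklore] -/
theorem eq_sum_monomial (k : Type) [Field k] (f : MvPolynomial (Fin 6) k) (hf : f = X 5 ^ 2 + X 0 ^ 6 * X 5 + X 0 ^ 13 + X 0 ^ 14 + X 1 ^ 3 + X 2 ^ 3 + X 3 ^ 3 + X 4 ^ 7) :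
    f = monomial (Finsupp.equivFunOnFinite.symm ![0, 0, 0, 0, 0, 2]) 1 + monomial (Finsupp.equivFunOnFinite.symm ![0, 0, 0, 0, 7, 0]) 1 +
      monomial (Finsupp.equivFunOnFinite.symm ![0, 0, 0, 3, 0, 0]) 1 + monomial (Finsupp.equivFunOnFinite.symm ![0, 0, 3, 0, 0, 0]) 1 +
      monomial (Finsupp.equivFunOnFinite.symm ![0, 3, 0, 0, 0, 0]) 1 + monomial (Finsupp.equivFunOnFinite.symm ![6, 0, 0, 0, 0, 1]) 1 +
      monomial (Finsupp.equivFunOnFinite.symm ![13, 0, 0, 0, 0, 0]) 1 + monomial (Finsupp.equivFunOnFinite.symm ![14, 0, 0, 0, 0, 0]) 1 := by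
  have hs : ∀ (i : Fin 6) (e : ℕ) (v : Fin 6 → ℕ), (Pi.single i e : Fin 6 → ℕ) = v →
      (X i : MvPolynomial (Fin 6) k) ^ e = monomial (Finsupp.equivFunOnFinite.symm v) 1 := by
    intro i e v hv
    have he : Finsupp.single i e = Finsupp.equivFunOnFinite.symm v :=
      DFunLike.coe_injective (by rw [Finsupp.single_eq_pi_single, Finsupp.coe_equivFunOnFinite_symm, hv])
    rw [X_pow_eq_monomial, he]
  have hmix : (X 0 : MvPolynomial (Fin 6) k) ^ 6 * X 5 = monomial (Finsupp.equivFunOnFinite.symm ![6, 0, 0, 0, 0, 1]) 1 := by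
    have he : Finsupp.single (0 : Fin 6) 6 + Finsupp.single 5 1 = Finsupp.equivFunOnFinite.symm ![6, 0, 0, 0, 0, 1] :=
      DFunLike.coe_injective (by
        rw [Finsupp.coe_add, Finsupp.single_eq_pi_single, Finsupp.single_eq_pi_single, Finsupp.coe_equivFunOnFinite_symm]; decide)
    rw [X_pow_eq_monomial, X, monomial_mul, one_mul, he]
  rw [hf, hmix, hs 5 2 ![0, 0, 0, 0, 0, 2] (by decide), hs 0 13 ![13, 0, 0, 0, 0, 0] (by decide), hs 0 14 ![14, 0, 0, 0, 0, 0] (by decide),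
    hs 1 3 ![0, 3, 0, 0, 0, 0] (by decide), hs 2 3 ![0, 0, 3, 0, 0, 0] (by decide), hs 3 3 ![0, 0, 0, 3, 0, 0] (by decide), hs 4 7 ![0, 0, 0, 0, 7, 0] (by decide)]
  ring

/-- ★ **`f′` IS CONVENIENT**: the pure powers `x¹³, y³, u³, t³, s⁷, z²` have non-zero coefficient (any field). [folklore] -/
theorem hconv (k : Type) [Field k] (f : MvPolynomial (Fin 6) k) (hf : f = X 5 ^ 2 + X 0 ^ 6 * X 5 + X 0 ^ 13 + X 0 ^ 14 + X 1 ^ 3 + X 2 ^ 3 + X 3 ^ 3 + X 4 ^ 7) :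
    ∀ j : Fin 6, ∃ N : ℕ, 0 < N ∧ MvPolynomial.coeff (Finsupp.single j N) f ≠ 0 := by
  classical
  have conv : ∀ (j : Fin 6) (N : ℕ), Finsupp.single j N = Finsupp.equivFunOnFinite.symm (Pi.single j N) := fun j N =>
    DFunLike.coe_injective (by rw [Finsupp.single_eq_pi_single, Finsupp.coe_equivFunOnFinite_symm])
  have key : ∀ (j : Fin 6) (N : ℕ), (Pi.single j N : Fin 6 → ℕ) ∈ ([![13, 0, 0, 0, 0, 0], ![0, 3, 0, 0, 0, 0], ![0, 0, 3, 0, 0, 0], ![0, 0, 0, 3, 0, 0],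
      ![0, 0, 0, 0, 7, 0], ![0, 0, 0, 0, 0, 2]] : List (Fin 6 → ℕ)) → MvPolynomial.coeff (Finsupp.single j N) f ≠ 0 := by
    intro j N hw
    rw [conv, eq_sum_monomial k f hf]
    simp only [coeff_add, coeff_monomial, EmbeddingLike.apply_eq_iff_eq]
    generalize (Pi.single j N : Fin 6 → ℕ) = w at hw ⊢
    simp only [List.mem_cons, List.mem_nil_iff, or_false] at hw
    rcases hw with rfl | rfl | rfl | rfl | rfl | rfl <;> simp (config := { decide := true })
  intro j
  fin_cases j
  · exact ⟨13, by norm_num, key 0 13 (by decide)⟩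
  · exact ⟨3, by norm_num, key 1 3 (by decide)⟩
  · exact ⟨3, by norm_num, key 2 3 (by decide)⟩
  · exact ⟨3, by norm_num, key 3 3 (by decide)⟩
  · exact ⟨7, by norm_num, key 4 7 (by decide)⟩
  · exact ⟨2, by norm_num, key 5 2 (by decide)⟩

/-- **`σ₇ f = f′`** (`σ₇ : z ↦ z + x⁷`, `z = X 5`, characteristic 2): the cross term `2x⁷z` dies. [folklore] -/
theorem aeval_shift (k : Type) [Field k] [CharP k 2] (f f' : MvPolynomial (Fin 6) k) (hf : f = X 5 ^ 2 + X 0 ^ 6 * X 5 + X 1 ^ 3 + X 2 ^ 3 + X 3 ^ 3 + X 4 ^ 7)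
    (hf' : f' = X 5 ^ 2 + X 0 ^ 6 * X 5 + X 0 ^ 13 + X 0 ^ 14 + X 1 ^ 3 + X 2 ^ 3 + X 3 ^ 3 + X 4 ^ 7) :
    aeval (fun l : Fin 6 => if l = 5 then X 5 + C (1 : k) * X 0 ^ 7 else (X l : MvPolynomial (Fin 6) k)) f = f' := by
  have h2 : (2 : MvPolynomial (Fin 6) k) = 0 := by
    have h := CharP.cast_eq_zero (MvPolynomial (Fin 6) k) 2
    simpa using h
  have e : aeval (fun l : Fin 6 => if l = 5 then X 5 + C (1 : k) * X 0 ^ 7 else (X l : MvPolynomial (Fin 6) k)) f = f' + 2 * (X 0 ^ 7 * X 5) := by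
    subst hf hf'
    simp only [map_add, map_mul, map_pow, aeval_X, C_1, one_mul]
    simp only [Fin.isValue, Fin.reduceEq, if_false, if_true]
    ring
  rw [e, h2, zero_mul, add_zero]

/-! ## §2 ★★ The unconditional two-sided point-floor row of d5lx6q7 -/

/-- ★★ **THE POINT-FLOOR ROW OF d5lx6q7 `z² + x⁶z + y³ + u³ + t³ + s⁷` (char 2, `k = k̄`, six variables) — LEGAL ∧ NOT F(5)-iso ∧ CURED, UNCONDITIONALLY**: one term on
✓ p688090 `F108ClassRow.pointFloorRow_of_convenient_of_ringEquiv` (σ₇ from `PolyAutRowTransport.exists_translate`; hypotheses from `Sigma7Lx6q7d5Specimen` /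
`Sigma7Lx6q7d5PointFloor`: prime, convenient, weakly non-degenerate, x̄ᵢ ≠ 0, regular off the vertex, θ-charts, Fedder witness at the x-chart origin, vertex singular).
[OURS · thin application; cite: IshiiSingularities2018, Thm. 4.4.23; Fedder1983, Thm. 1.12; GortzWedhorn2020, (13.19)] -/
theorem pointFloorRow_Lx6q7d5_uncond (k : Type) [Field k] [IsAlgClosed k] [CharP k 2] (f : MvPolynomial (Fin 6) k)
    (hf : f = X 5 ^ 2 + X 0 ^ 6 * X 5 + X 1 ^ 3 + X 2 ^ 3 + X 3 ^ 3 + X 4 ^ 7) :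
    ∀ (v' : Spec (.of (MvPolynomial (Fin 6) k ⧸ Ideal.span {f}))),
      v'.asIdeal = Ideal.span (Set.range fun j : Fin 6 => Ideal.Quotient.mk (Ideal.span {f}) (X j)) →
      ∀ (S' : Scheme.{0}) (g₁ : S' ⟶ Spec ((Spec (.of (MvPolynomial (Fin 6) k ⧸ Ideal.span {f}))).presheaf.stalk v')),
        IsBlowup g₁ ((affineBlowup.idealSheaf (Ideal.span (Set.range fun j : Fin 6 => Ideal.Quotient.mk (Ideal.span {f}) (X j)))).comap
          ((Spec (.of (MvPolynomial (Fin 6) k ⧸ Ideal.span {f}))).fromSpecStalk v')) →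
        (((affineBlowup.idealSheaf (Ideal.span (Set.range fun j : Fin 6 => Ideal.Quotient.mk (Ideal.span {f}) (X j)))).comap
            ((Spec (.of (MvPolynomial (Fin 6) k ⧸ Ideal.span {f}))).fromSpecStalk v')) ≠ ⊥ ∧
          ((((affineBlowup.idealSheaf (Ideal.span (Set.range fun j : Fin 6 => Ideal.Quotient.mk (Ideal.span {f}) (X j)))).comap
            ((Spec (.of (MvPolynomial (Fin 6) k ⧸ Ideal.span {f}))).fromSpecStalk v')).support :
              Set (Spec ((Spec (.of (MvPolynomial (Fin 6) k ⧸ Ideal.span {f}))).presheaf.stalk v'))) ⊆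
            (Scheme.regularLocus (Spec ((Spec (.of (MvPolynomial (Fin 6) k ⧸ Ideal.span {f}))).presheaf.stalk v')))ᶜ) ∧
          (∀ s : S', g₁.base s ≠ closedPoint _ → s ∈ Scheme.regularLocus S') ∧ (∀ s : S', CMCl (S'.presheaf.stalk s))) ∧
        (∃ s : S', g₁.base s = closedPoint _ ∧ ¬ FullCl 2 (S'.presheaf.stalk s)) ∧
        (∃ 𝓚 : S'.IdealSheafData, 𝓚 ≠ ⊥ ∧ (∀ s ∈ (𝓚.support : Set S'), g₁.base s = closedPoint _) ∧
          ∀ (S'' : Scheme.{0}) (π : S'' ⟶ S'), IsBlowup π 𝓚 → ∀ s : S'', FullCl 2 (S''.presheaf.stalk s)) := by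
  haveI : Fact (Nat.Prime 2) := ⟨Nat.prime_two⟩
  obtain ⟨φ, hφ, h₁, h₂⟩ := PolyAutRowTransport.exists_translate k (0 : Fin 6) 5 (by decide) (1 : k) 7 (by norm_num)
  exact F108ClassRow.pointFloorRow_of_convenient_of_ringEquiv k 2 (by norm_num) φ h₁ h₂ f _ (by rw [hφ]; exact aeval_shift k f _ hf rfl)
    (Sigma7Lx6q7d5Specimen.prime_f k _ rfl) (hconv k _ rfl) (Sigma7Lx6q7d5Specimen.weaklyNondegenerate k _ rfl) (Sigma7Lx6q7d5Specimen.mk_X_ne_zero k _ rfl)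
    (fun x hx => Sigma7Lx6q7d5Specimen.regular_off_vertex k _ rfl x.asIdeal hx) (fun _ : Fin 6 => 2) _ (Sigma7Lx6q7d5PointFloor.theta k _ rfl)
    (Sigma7Lx6q7d5Specimen.f_not_mem_span_X k _ rfl) (Sigma7Lx6q7d5PointFloor.g_not_mem_span_X k) (Sigma7Lx6q7d5Specimen.constantCoeff_f k _ rfl) 0
    (Sigma7Lx6q7d5PointFloor.constantCoeff_g_zero k) (Sigma7Lx6q7d5PointFloor.g_zero_mem_frobeniusPower k)
    (fun v hv => Sigma7Lx6q7d5PointFloor.vertex_not_mem_regularLocus k _ rfl v hv)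

/-! ## §3 ★ The germ shape, unconditionally -/

/-- ★ **`FInjectivizationGermAt 2 v` at the vertex of `V(f′)`** from `affineBlowup_fullCl_of_convenient` (the centre `A` contains a pure power of every variable, so `𝔪 ⊆ √I_A` and
`I_A ≠ ⊥`). [OURS · thin application; cite: GortzWedhorn2020, Prop. 13.91 (2)] -/
theorem shifted_fInjectivizationGermAt_uncond (k : Type) [Field k] [IsAlgClosed k] [CharP k 2] (f : MvPolynomial (Fin 6) k) (hf : f = X 5 ^ 2 + X 0 ^ 6 * X 5 + X 0 ^ 13 + X 0 ^ 14 + X 1 ^ 3 + X 2 ^ 3 + X 3 ^ 3 + X 4 ^ 7)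
    (v : Spec (.of (MvPolynomial (Fin 6) k ⧸ Ideal.span {f})))
    (hv : v.asIdeal = Ideal.span (Set.range (fun j : Fin 6 => Ideal.Quotient.mk (Ideal.span {f}) (X j)))) :
    FInjectivizationGermAt 2 v := by
  classical
  haveI : Fact (Nat.Prime 2) := ⟨Nat.prime_two⟩
  haveI hp : (Ideal.span {f}).IsPrime := Sigma7Lx6q7d5Specimen.isPrime_span_f k f hf
  haveI : IsDomain (MvPolynomial (Fin 6) k ⧸ Ideal.span {f}) := Ideal.Quotient.isDomain _
  obtain ⟨A, hprim, hfull⟩ := F108ClassRow.affineBlowup_fullCl_of_convenient k 2 f (Sigma7Lx6q7d5Specimen.prime_f k f hf) (hconv k f hf)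
    (Sigma7Lx6q7d5Specimen.weaklyNondegenerate k f hf) (Sigma7Lx6q7d5Specimen.mk_X_ne_zero k f hf) (fun x hx => Sigma7Lx6q7d5Specimen.regular_off_vertex k f hf x.asIdeal hx)
  have hpow : ∀ j : Fin 6, ∃ N : ℕ, (Ideal.Quotient.mk (Ideal.span {f}) (X j)) ^ N ∈
      Ideal.span ((fun e : Fin 6 →₀ ℕ => Ideal.Quotient.mk (Ideal.span {f}) (monomial e (1 : k))) '' (A : Set (Fin 6 →₀ ℕ))) := by
    intro j
    obtain ⟨N, hN⟩ := hprim j (Finset.mem_univ j)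
    refine ⟨N, ?_⟩
    have e : (Ideal.Quotient.mk (Ideal.span {f}) (X j)) ^ N = Ideal.Quotient.mk (Ideal.span {f}) (monomial (Finsupp.single j N) (1 : k)) := by
      rw [← map_pow, X_pow_eq_monomial]
    rw [e]
    exact Ideal.subset_span ⟨_, Finset.mem_coe.mpr hN, rfl⟩
  refine GermOfGlobalBlowup.fInjectivizationGermAt_of_affineBlowup 2 _ ?_ v ?_ hfull
  · obtain ⟨N, hN⟩ := hpow 0
    intro hbot
    rw [hbot, Ideal.mem_bot] at hN
    exact pow_ne_zero N (Sigma7Lx6q7d5Specimen.mk_X_ne_zero k f hf 0) hN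
  · rw [hv, Ideal.span_le]
    rintro _ ⟨j, rfl⟩
    obtain ⟨N, hN⟩ := hpow j
    exact ⟨N, hN⟩

/-- ★ **`FInjectivizationGermAt 2 v` AT THE VERTEX OF d5lx6q7, UNCONDITIONALLY** (transport of §3 along `σ₇` by `PolyAutRowTransport.fInjectivizationGermAt_of_algEquiv`).
[OURS · thin application; cite: GortzWedhorn2020, (13.19)] -/
theorem lx6q7d5_fInjectivizationGermAt_uncond (k : Type) [Field k] [IsAlgClosed k] [CharP k 2] (f : MvPolynomial (Fin 6) k)
    (hf : f = X 5 ^ 2 + X 0 ^ 6 * X 5 + X 1 ^ 3 + X 2 ^ 3 + X 3 ^ 3 + X 4 ^ 7) :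
    ∀ v' : Spec (.of (MvPolynomial (Fin 6) k ⧸ Ideal.span {f})),
      v'.asIdeal = Ideal.span (Set.range fun j : Fin 6 => Ideal.Quotient.mk (Ideal.span {f}) (X j)) → FInjectivizationGermAt 2 v' := by
  obtain ⟨φ, hφ, h₁, h₂⟩ := PolyAutRowTransport.exists_translate k (0 : Fin 6) 5 (by decide) (1 : k) 7 (by norm_num)
  exact PolyAutRowTransport.fInjectivizationGermAt_of_algEquiv k 2 φ h₁ h₂ f _ (by rw [hφ]; exact aeval_shift k f _ hf rfl)
    (fun v hv => shifted_fInjectivizationGermAt_uncond k _ rfl v hv)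

end Summit.ResolutionOfSingularities.ResolutionOfSingularities.Theorems.FInjectiveMacaulayfication.Sigma7Lx6q7d5PointFloorRowUncond

end
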